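import Summits.KontsevichZagierPeriods.Zeta5Search.LaiSweepShard

/-!
# `κ₃` sweep certificate — shard file 040 of 127 (shards 280–286 of 889)

HONEST FRAMING. Systematic search; no irrationality claim unless certified. This file only checks,
by `decide +kernel`, shards 280–286 of the order-cell sweep of the `κ₃` point `(74, 2180, 444; δ74)`
(engine `LaiSweepEngine`, soundness `LaiSweepJump/Free/Eval/Shard/Kappa3`; a shard is `⟨regime, n,
p, q, p', q', Lo, Up⟩`: `n` cells from `p/q` to `p'/q'` with integer rate sums in `[Lo, Up]`, `K =
128`, `D = 2^40`). It draws NO conclusion: only the capstone `LaiKappa3SweepCert`, which needs all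
127 shard files, does. Kernel cost of this file ≈ 560 cells × 0.3 s.
-/

namespace Summit.KontsevichZagierPeriods.Zeta5Search.Sweep

set_option maxHeartbeats 100000000 in
/-- Shard 280: 80 cells of regime B from `37/158` to `77/327`.
[cite: Lai2024BallRivoal, §4 Lemma 4.3] -/
theorem shard280 :
    Shard.check 128 (2^40)
      ⟨true, 80, 37, 158, 77, 327, 29088794265438, 30280804241093⟩ = true := by
  decide +kernel

set_option maxHeartbeats 100000000 in
/-- Shard 281: 80 cells of regime B from `77/327` to `71/300`.
[cite: Lai2024BallRivoal, §4 Lemma 4.3] -/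
theorem shard281 :
    Shard.check 128 (2^40)
      ⟨true, 80, 77, 327, 71, 300, 26560579162699, 27660615329916⟩ = true := by
  decide +kernel

set_option maxHeartbeats 100000000 in
/-- Shard 282: 80 cells of regime B from `71/300` to `64/269`.
[cite: Lai2024BallRivoal, §4 Lemma 4.3] -/
theorem shard282 :
    Shard.check 128 (2^40)
      ⟨true, 80, 71, 300, 64, 269, 27783730795025, 28948270635247⟩ = true := by
  decide +kernel

set_option maxHeartbeats 100000000 in
/-- Shard 283: 80 cells of regime B from `64/269` to `94/393`.
[cite: Lai2024BallRivoal, §4 Lemma 4.3] -/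
theorem shard283 :
    Shard.check 128 (2^40)
      ⟨true, 80, 64, 269, 94, 393, 27998267295695, 29187241548896⟩ = true := by
  decide +kernel

set_option maxHeartbeats 100000000 in
/-- Shard 284: 80 cells of regime B from `94/393` to `1155/4804`.
[cite: Lai2024BallRivoal, §4 Lemma 4.3] -/
theorem shard284 :
    Shard.check 128 (2^40)
      ⟨true, 80, 94, 393, 1155, 4804, 27284271291954, 28456535717622⟩ = true := by
  decide +kernel

set_option maxHeartbeats 100000000 in
/-- Shard 285: 80 cells of regime B from `1155/4804` to `51/211`.
[cite: Lai2024BallRivoal, §4 Lemma 4.3] -/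
theorem shard285 :
    Shard.check 128 (2^40)
      ⟨true, 80, 1155, 4804, 51, 211, 27961372072453, 29177134701210⟩ = true := by
  decide +kernel

set_option maxHeartbeats 100000000 in
/-- Shard 286: 80 cells of regime B from `51/211` to `69/284`.
[cite: Lai2024BallRivoal, §4 Lemma 4.3] -/
theorem shard286 :
    Shard.check 128 (2^40)
      ⟨true, 80, 51, 211, 69, 284, 27296729894406, 28497673878104⟩ = true := by
  decide +kernel

/-- The checked shards of this file, in order. [folklore] -/
def shards040 : List (CheckedShard 128 (2^40)) :=
  [⟨_, shard280⟩, ⟨_, shard281⟩, ⟨_, shard282⟩, ⟨_, shard283⟩, ⟨_, shard284⟩,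
    ⟨_, shard285⟩, ⟨_, shard286⟩]

end Summit.KontsevichZagierPeriods.Zeta5Search.Sweep
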